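import Summits.Parity.BatemanHorn.Theorems.SoloInformedThinCounting
import Mathlib.Analysis.SpecialFunctions.Pow.Asymptotics
import HarnessLib

/-!
# Thin sequences vs. Type-I information, VII: general comparison sequences

Part of the `SoloInformedThin*` series; companion of `SoloInformedThinComparison` (the Type-II
half).  The file `…TypeI` treats Ford–Maynard's bound (I) for `w = a − 1`; here the comparison
sequence `b` is general: `0 ≤ b ≤ x^η` with mass `∑_{x/2 < pn ≤ x} b(pn) ≥ x/(4p)` on the
multiples of every prime `p ≤ x^γ`.

* `card_window_le` — `#{n ≤ x : x/2 < pn ≤ x} ≤ x/(2p) + 1`;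
* `typeI_sparse_le_cmp` — primes `M < p ≤ x^γ` of `S`, `A ⊇ supp a ∩ (x/2, x]`, `0 ≤ b ≤ β`:
  `∑_{p ∈ S} ∑_{x/2 < pn ≤ x} b(pn) − (#A · log x/log M) · β · (x/(2M) + 1) ≤ x/(log x)^B`;
* `eventually_not_typeI_of_sparse_cmp` — `0 ≤ η < c ≤ 1`, `γ > 1 − c + η`, `B > 1`: for all
  large `x`, no real `a` with at most `x^{1−c}` non-zero values on `(x/2, x]` and no such `b` have
  `w = a − b` satisfying (I) at level `x^γ`.
Together with `eventually_not_typeII_of_sparse_cmp`: against ANY comparison sequence of height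
`≤ x^η` which is well distributed on multiples of primes, the (I)/(II) budget of a sequence with
`x^{1−c}` non-zero values on `(x/2, x]` is contained in `{γ ≤ 1 − c + η} × {θ ≥ c − η}`.

References: [cite: FordMaynard2024PrimeSieves, §2.4 (p. 7, first family)]
[cite: FordMaynard2024PrimeSieves, §4.2 (hypotheses (b.1), (b.2), Lemma 4.6)]
[cite: FordMaynard2024PrimeSieves, §1 (I)].
-/

noncomputable section

open Filter Finset Real

namespace Summit.Parity.BatemanHorn.Theorems

open Literature.Barriers.Parity.FordMaynard (TypeI eventually_mul_rpow_le_rpow)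

/-- The dyadic window of cofactors: `#{1 ≤ n ≤ x : x/2 < pn ≤ x} ≤ x/(2p) + 1`. [folklore] -/
theorem card_window_le {x : ℝ} (hx : 0 ≤ x) {p : ℕ} (hp : 0 < p) :
    ((((Icc 1 ⌊x⌋₊).filter
        (fun n : ℕ => x / 2 < (p * n : ℝ) ∧ (p * n : ℝ) ≤ x)).card : ℕ) : ℝ)
      ≤ x / (2 * p) + 1 := by
  have hp' : (0 : ℝ) < p := by exact_mod_cast hp
  have hsub : (Icc 1 ⌊x⌋₊).filter (fun n : ℕ => x / 2 < (p * n : ℝ) ∧ (p * n : ℝ) ≤ x) ⊆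
      Ioc ⌊x / (2 * p)⌋₊ ⌊x / p⌋₊ := by
    intro n hn
    rw [Finset.mem_filter] at hn
    obtain ⟨_, h1, h2⟩ := hn
    rw [mem_Ioc]
    constructor
    · have : x / (2 * p) < n := by
        rw [div_lt_iff₀ (by positivity)]
        linarith
      exact (Nat.floor_lt (by positivity)).mpr this
    · have : (n : ℝ) ≤ x / p := by
        rw [le_div_iff₀ hp']
        linarith
      exact Nat.le_floor this
  have hfl : ⌊x / (2 * p)⌋₊ ≤ ⌊x / p⌋₊ :=
    Nat.floor_le_floor (div_le_div_of_nonneg_left hx hp' (by linarith))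
  have h2 : (⌊x / p⌋₊ : ℝ) ≤ x / p := Nat.floor_le (by positivity)
  have h3 : x / (2 * p) - 1 < ⌊x / (2 * p)⌋₊ := Nat.sub_one_lt_floor _
  have h4 : x / p = 2 * (x / (2 * p)) := by
    field_simp
  calc ((((Icc 1 ⌊x⌋₊).filter
          (fun n : ℕ => x / 2 < (p * n : ℝ) ∧ (p * n : ℝ) ≤ x)).card : ℕ) : ℝ)
        ≤ (((Ioc ⌊x / (2 * p)⌋₊ ⌊x / p⌋₊).card : ℕ) : ℝ) := by
          exact_mod_cast card_le_card hsub
    _ = (⌊x / p⌋₊ : ℝ) - ⌊x / (2 * p)⌋₊ := by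
          rw [Nat.card_Ioc, Nat.cast_sub hfl]
    _ ≤ x / (2 * p) + 1 := by linarith

/-- **(I) against a thin support, general comparison.**  Let `S` be a finite set of primes
`M < p ≤ x^γ`, let `A` contain the support of `a` on `(x/2, x]`, and let `0 ≤ b ≤ β`.  If
`w = a − b` satisfies (I) at level `x^γ`, then
`∑_{p ∈ S} ∑_{x/2 < pn ≤ x} b(pn) − (#A · log x / log M) · (β · (x/(2M) + 1)) ≤ x/(log x)^B`.
[cite: FordMaynard2024PrimeSieves, §2.4] -/
theorem typeI_sparse_le_cmp {a b : ℕ → ℝ} {x γ B β : ℝ} (hB : 0 ≤ B) (hx : 1 ≤ x) {M : ℝ}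
    (hM : 1 < M) (S A : Finset ℕ)
    (hS : ∀ p ∈ S, p.Prime ∧ M < (p : ℝ) ∧ (p : ℝ) ≤ x ^ γ)
    (hA : ∀ v : ℕ, x / 2 < (v : ℝ) → (v : ℝ) ≤ x → a v ≠ 0 → v ∈ A)
    (hb0 : ∀ n, 0 ≤ b n) (hbβ : ∀ n, b n ≤ β)
    (h : TypeI (fun n : ℕ => a n - b n) x γ B) :
    ∑ p ∈ S, ∑ n ∈ (Icc 1 ⌊x⌋₊).filter
        (fun n : ℕ => x / 2 < (p * n : ℝ) ∧ (p * n : ℝ) ≤ x), b (p * n)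
      - A.card * (Real.log x / Real.log M) * (β * (x / (2 * M) + 1))
      ≤ x / Real.log x ^ B := by
  have hβ : 0 ≤ β := (hb0 0).trans (hbβ 0)
  set L := Real.log x / Real.log M with hL
  set T : Finset ℕ := Icc 1 ⌊x⌋₊ with hTdef
  set Nw : ℕ → Finset ℕ := fun m : ℕ =>
    T.filter (fun n : ℕ => x / 2 < (m * n : ℝ) ∧ (m * n : ℝ) ≤ x) with hNw
  have key : ∑ m ∈ Icc 1 ⌊x ^ γ⌋₊, ((m.divisors.card : ℝ) ^ B) *
      |∑ n ∈ Nw m, (a (m * n) - b (m * n))| ≤ x / Real.log x ^ B := h (fun _ => (1, ⌊x⌋₊))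
  -- bad primes `Sb` (some cofactor carries a non-zero value of `a`) and good primes `Sg`
  set Sb : Finset ℕ := S.filter (fun p : ℕ => ∃ r : ℕ, r ∈ T ∧
      (x / 2 < (p * r : ℝ) ∧ (p * r : ℝ) ≤ x) ∧ a (p * r) ≠ 0) with hSb
  set Sg : Finset ℕ := S.filter (fun p : ℕ => ¬ ∃ r : ℕ, r ∈ T ∧
      (x / 2 < (p * r : ℝ) ∧ (p * r : ℝ) ≤ x) ∧ a (p * r) ≠ 0) with hSg
  have hS' : ∀ p ∈ S, p.Prime ∧ M < (p : ℝ) := fun p hp => ⟨(hS p hp).1, (hS p hp).2.1⟩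
  have hSsub : S ⊆ Icc 1 ⌊x ^ γ⌋₊ := fun p hp => by
    rw [mem_Icc]; exact ⟨(hS p hp).1.one_le, Nat.le_floor (hS p hp).2.2⟩
  have hSgS : Sg ⊆ S := by rw [hSg]; exact filter_subset _ _
  have hSbS : Sb ⊆ S := by rw [hSb]; exact filter_subset _ _
  have hM0 : 0 < M := by linarith
  have hL0 : 0 ≤ L := div_nonneg (Real.log_nonneg hx) (Real.log_nonneg hM.le)
  -- good primes: the Type-I term is exactly the `b`-mass on the multiples of `p`
  have hgoodterm : ∀ p ∈ Sg, ∑ n ∈ Nw p, b (p * n) ≤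
      ((p.divisors.card : ℝ) ^ B) * |∑ n ∈ Nw p, (a (p * n) - b (p * n))| := by
    intro p hp
    have hp' := hp
    simp only [hSg, Finset.mem_filter] at hp'
    obtain ⟨hpS, hg⟩ := hp'
    have hpr := (hS p hpS).1
    have hzero : ∀ n ∈ Nw p, a (p * n) = 0 := by
      intro n hn
      have hn' := hn
      simp only [hNw, Finset.mem_filter] at hn'
      by_contra hne
      exact hg ⟨n, hn'.1, hn'.2, hne⟩
    have hinner : ∑ n ∈ Nw p, (a (p * n) - b (p * n)) = -∑ n ∈ Nw p, b (p * n) := by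
      rw [← Finset.sum_neg_distrib]
      refine sum_congr rfl fun n hn => ?_
      rw [hzero n hn]
      ring
    have hnn : 0 ≤ ∑ n ∈ Nw p, b (p * n) := sum_nonneg fun n _ => hb0 _
    rw [hinner, abs_neg, abs_of_nonneg hnn]
    have hcardpos : 0 < p.divisors.card :=
      Finset.card_pos.mpr ⟨1, Nat.one_mem_divisors.mpr hpr.ne_zero⟩
    have hτ1 : (1 : ℝ) ≤ (p.divisors.card : ℝ) := by exact_mod_cast hcardpos
    have hτ : (1 : ℝ) ≤ (p.divisors.card : ℝ) ^ B := Real.one_le_rpow hτ1 hB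
    exact le_mul_of_one_le_left hnn hτ
  have h1 : ∑ p ∈ Sg, ∑ n ∈ Nw p, b (p * n) ≤ x / Real.log x ^ B :=
    calc ∑ p ∈ Sg, ∑ n ∈ Nw p, b (p * n)
        ≤ ∑ p ∈ Sg, ((p.divisors.card : ℝ) ^ B) * |∑ n ∈ Nw p, (a (p * n) - b (p * n))| :=
          sum_le_sum hgoodterm
      _ ≤ ∑ m ∈ Icc 1 ⌊x ^ γ⌋₊, ((m.divisors.card : ℝ) ^ B) *
            |∑ n ∈ Nw m, (a (m * n) - b (m * n))| :=
          sum_le_sum_of_subset_of_nonneg (hSgS.trans hSsub)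
            (fun m _ _ => mul_nonneg (Real.rpow_nonneg (Nat.cast_nonneg _) _) (abs_nonneg _))
      _ ≤ x / Real.log x ^ B := key
  -- bad primes: at most `#A · L` of them, each carrying `b`-mass at most `β (x/(2M) + 1)`
  have h2 : (Sb.card : ℝ) ≤ A.card * L :=
    card_badPrimes_le hx hM S T A Sb hS' hA (fun p hp => by
      have hp' := hp
      simp only [hSb, Finset.mem_filter] at hp'
      exact hp')
  have h3 : ∑ p ∈ Sb, ∑ n ∈ Nw p, b (p * n) ≤ Sb.card * (β * (x / (2 * M) + 1)) := by
    rw [← nsmul_eq_mul, ← sum_const]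
    refine sum_le_sum fun p hp => ?_
    have hMp := (hS p (hSbS hp)).2.1
    have hpr := (hS p (hSbS hp)).1
    have hp0 : (0 : ℝ) < p := by exact_mod_cast hpr.pos
    have hwin : x / (2 * p) ≤ x / (2 * M) :=
      div_le_div_of_nonneg_left (by linarith) (by positivity) (by linarith)
    have hcard : ((Nw p).card : ℝ) ≤ x / (2 * M) + 1 := by
      have := card_window_le (by linarith : (0 : ℝ) ≤ x) hpr.pos
      simp only [hNw, hTdef] at this ⊢
      linarith
    calc ∑ n ∈ Nw p, b (p * n) ≤ ∑ _n ∈ Nw p, β := sum_le_sum fun n _ => hbβ _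
      _ = (Nw p).card * β := by rw [sum_const, nsmul_eq_mul]
      _ ≤ (x / (2 * M) + 1) * β := mul_le_mul_of_nonneg_right hcard hβ
      _ = β * (x / (2 * M) + 1) := by ring
  have hsplit : ∑ p ∈ Sb, ∑ n ∈ Nw p, b (p * n) + ∑ p ∈ Sg, ∑ n ∈ Nw p, b (p * n) =
      ∑ p ∈ S, ∑ n ∈ Nw p, b (p * n) := by
    rw [hSb, hSg]
    exact sum_filter_add_sum_filter_not S _ _
  have h4 : (Sb.card : ℝ) * (β * (x / (2 * M) + 1)) ≤ A.card * L * (β * (x / (2 * M) + 1)) :=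
    mul_le_mul_of_nonneg_right h2 (by positivity)
  linarith

/-- **No Type-I information above the density, general comparison.**  Let `0 ≤ η < c ≤ 1`,
`γ > 1 − c + η`, `B > 1`.  For all large `x`: for no real sequence `a` with at most `x^{1−c}`
non-zero values on `(x/2, x]` and no comparison sequence `b` with `0 ≤ b ≤ x^η` and
`∑_{x/2 < pn ≤ x} b(pn) ≥ x/(4p)` for every prime `p ≤ x^γ` does `w = a − b` satisfy (I) at level
`x^γ`. [cite: FordMaynard2024PrimeSieves, §2.4] [cite: FordMaynard2024PrimeSieves, §4.2] -/
theorem eventually_not_typeI_of_sparse_cmp {c γ B η : ℝ} (hη : 0 ≤ η) (hηc : η < c)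
    (hc1 : c ≤ 1) (hγ : 1 - c + η < γ) (hB : 1 < B) :
    ∀ᶠ x : ℝ in atTop, ∀ (a b : ℕ → ℝ) (A : Finset ℕ), (A.card : ℝ) ≤ x ^ (1 - c) →
      (∀ v : ℕ, x / 2 < (v : ℝ) → (v : ℝ) ≤ x → a v ≠ 0 → v ∈ A) →
      (∀ n, 0 ≤ b n) → (∀ n, b n ≤ x ^ η) →
      (∀ p : ℕ, p.Prime → (p : ℝ) ≤ x ^ γ →
        x / (4 * p) ≤ ∑ n ∈ (Icc 1 ⌊x⌋₊).filter
          (fun n : ℕ => x / 2 < (p * n : ℝ) ∧ (p * n : ℝ) ≤ x), b (p * n)) →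
      ¬ TypeI (fun n : ℕ => a n - b n) x γ B := by
  obtain ⟨K, hK1, hK⟩ := exists_card_primes_Ioc_two_mul_ge
  have hK0 : 0 < K := by linarith
  -- the scale `M ≍ x^(1 - c')` with `max(1-γ, 0) < c' < c - η`
  have hmax0 : (0 : ℝ) ≤ max (1 - γ) 0 := le_max_right _ _
  have hmax1 : 1 - γ ≤ max (1 - γ) 0 := le_max_left _ _
  have hmaxc : max (1 - γ) 0 < c - η := max_lt (by linarith) (by linarith)
  set c' : ℝ := (max (1 - γ) 0 + (c - η)) / 2 with hc'def
  have hc'c : c' < c - η := by rw [hc'def]; linarith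
  have hc'0 : 0 < c' := by rw [hc'def]; linarith
  have hc'1 : 1 - c' < 1 := by linarith
  have hc'γ : 1 - c' < γ := by rw [hc'def]; linarith
  have hδ : 0 < (c - η - c') / 4 := by linarith
  filter_upwards [eventually_ge_atTop (4 : ℝ),
    eventually_mul_rpow_le_rpow 6 hc'γ,
    eventually_mul_rpow_le_rpow 6 hc'1,
    eventually_mul_rpow_le_rpow (64 * K)
      (by linarith : 1 - c + η + c' + (c - η - c') / 4 + (c - η - c') / 4 < 1),
    eventually_mul_rpow_le_rpow 2 hc'0,
    (isLittleO_log_rpow_atTop hδ).bound one_pos,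
    ((tendsto_rpow_atTop (by linarith : 0 < B - 1)).comp
      Real.tendsto_log_atTop).eventually_gt_atTop (8 * (2 * K))]
    with x hx4 e1 e2 e3 e5 elog e4 a b A hA hcov hb0 hbη hbm hI
  rw [Real.rpow_one] at e2 e3
  rw [Real.rpow_zero, mul_one] at e5
  have hx0 : 0 < x := by linarith
  have hx1 : 1 ≤ x := by linarith
  have hlx : 0 ≤ Real.log x := Real.log_nonneg hx1
  have hlx0 : 0 < Real.log x := Real.log_pos (by linarith)
  have hlogle : Real.log x ≤ x ^ ((c - η - c') / 4) := by
    have := elog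
    simp only [one_mul, Real.norm_eq_abs] at this
    rwa [abs_of_nonneg hlx, abs_of_nonneg (Real.rpow_nonneg hx0.le _)] at this
  have e4' : 8 * (2 * K) < Real.log x ^ (B - 1) := by simpa using e4
  set M : ℕ := ⌊x ^ (1 - c')⌋₊ + 2 with hMdef
  have hM2 : 2 ≤ M := by omega
  have hM2r : (2 : ℝ) ≤ M := by exact_mod_cast hM2
  have hM0 : (0 : ℝ) < M := by linarith
  have hMlow : x ^ (1 - c') < M := by
    have := Nat.lt_floor_add_one (x ^ (1 - c'))
    push_cast [hMdef]
    linarith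
  have hx1c : 1 ≤ x ^ (1 - c') := Real.one_le_rpow hx1 (by linarith)
  have hMle : (M : ℝ) ≤ 3 * x ^ (1 - c') := by
    have h1 : (⌊x ^ (1 - c')⌋₊ : ℝ) ≤ x ^ (1 - c') := Nat.floor_le (Real.rpow_nonneg hx0.le _)
    push_cast [hMdef]
    linarith
  set S : Finset ℕ := (Ioc M (2 * M)).filter Nat.Prime with hSdef
  have hSprop : ∀ p ∈ S, p.Prime ∧ (M : ℝ) < p ∧ (p : ℝ) ≤ x ^ γ := by
    intro p hp
    rw [hSdef, mem_filter, mem_Ioc] at hp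
    obtain ⟨⟨hMp, hp2M⟩, hpr⟩ := hp
    have hMp' : (M : ℝ) < p := by exact_mod_cast hMp
    have hp2M' : (p : ℝ) ≤ 2 * M := by exact_mod_cast hp2M
    exact ⟨hpr, hMp', by linarith⟩
  have hmain := typeI_sparse_le_cmp (by linarith) hx1 (by linarith : (1 : ℝ) < M) S A hSprop
    hcov hb0 hbη hI
  have hL : Real.log x / Real.log M ≤ 2 * Real.log x := by
    have hlogM : Real.log 2 ≤ Real.log M := Real.log_le_log two_pos hM2r
    have hl2 := Real.log_two_gt_d9
    rw [div_le_iff₀ (by linarith)]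
    nlinarith
  have hcardS := hK M (by omega)
  have h2Mx : 2 * (M : ℝ) ≤ x := by linarith
  -- the `b`-mass on multiples of the primes of `S`
  have hsum : (S.card : ℝ) * (x / (8 * M)) ≤ ∑ p ∈ S, ∑ n ∈ (Icc 1 ⌊x⌋₊).filter
      (fun n : ℕ => x / 2 < (p * n : ℝ) ∧ (p * n : ℝ) ≤ x), b (p * n) := by
    rw [← nsmul_eq_mul, ← sum_const]
    refine sum_le_sum fun p hp => ?_
    have hp2M : (p : ℝ) ≤ 2 * M := by
      have := hp; rw [hSdef, mem_filter, mem_Ioc] at this; exact_mod_cast this.1.2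
    obtain ⟨hpr, _, hpγ⟩ := hSprop p hp
    have hp0 : (0 : ℝ) < p := by exact_mod_cast hpr.pos
    have : x / (8 * M) ≤ x / (4 * p) :=
      div_le_div_of_nonneg_left hx0.le (by positivity) (by linarith)
    exact this.trans (hbm p hpr hpγ)
  -- `#S · x/(8M) ≥ x/(8 K log x)`
  have hlog2M0 : 0 < Real.log (2 * M) := Real.log_pos (by linarith)
  have hlog2M : Real.log (2 * M) ≤ Real.log x := Real.log_le_log (by positivity) h2Mx
  have hSlow : x / (8 * K * Real.log x) ≤ (S.card : ℝ) * (x / (8 * M)) := by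
    have hMK : (M : ℝ) / (K * Real.log x) ≤ S.card :=
      le_trans (div_le_div_of_nonneg_left (by positivity) (mul_pos hK0 hlog2M0)
        (mul_le_mul_of_nonneg_left hlog2M hK0.le)) hcardS
    have hMne : (M : ℝ) ≠ 0 := hM0.ne'
    have hlxne : Real.log x ≠ 0 := hlx0.ne'
    have hKne : K ≠ 0 := hK0.ne'
    calc x / (8 * K * Real.log x) = (M : ℝ) / (K * Real.log x) * (x / (8 * M)) := by
          field_simp
      _ ≤ S.card * (x / (8 * M)) := mul_le_mul_of_nonneg_right hMK (by positivity)
  -- the subtracted Type-I term: `#A L · x^η (x/(2M) + 1) ≤ 2 x^{1-c+η+c'} log x ≤ x/(32 K log x)`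
  have hsubtr : (A.card : ℝ) * (Real.log x / Real.log M) * (x ^ η * (x / (2 * M) + 1)) ≤
      x / (32 * K * Real.log x) := by
    have hxc' : x ^ (1 - c') * x ^ c' = x := by
      rw [← Real.rpow_add hx0]; norm_num
    have s2 : x / (2 * M) ≤ x ^ c' / 2 := by
      rw [div_le_div_iff₀ (by positivity) two_pos]
      have : x ≤ M * x ^ c' :=
        calc x = x ^ (1 - c') * x ^ c' := hxc'.symm
          _ ≤ M * x ^ c' := mul_le_mul_of_nonneg_right hMlow.le (Real.rpow_nonneg hx0.le _)
      linarith
    have s2' : x / (2 * M) + 1 ≤ x ^ c' := by linarith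
    have hAL : (A.card : ℝ) * (Real.log x / Real.log M) ≤ x ^ (1 - c) * (2 * Real.log x) :=
      mul_le_mul hA hL (div_nonneg hlx (Real.log_nonneg (by linarith)))
        (Real.rpow_nonneg hx0.le _)
    have s1 : (A.card : ℝ) * (Real.log x / Real.log M) * (x ^ η * (x / (2 * M) + 1)) ≤
        (x ^ (1 - c) * (2 * Real.log x)) * (x ^ η * x ^ c') :=
      mul_le_mul hAL (mul_le_mul_of_nonneg_left s2' (Real.rpow_nonneg hx0.le _))
        (by positivity) (by positivity)
    have s3 : (x ^ (1 - c) * (2 * Real.log x)) * (x ^ η * x ^ c') =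
        2 * x ^ (1 - c + η + c') * Real.log x := by
      rw [Real.rpow_add hx0, Real.rpow_add hx0]; ring
    have hprod : x ^ (1 - c + η + c') * x ^ ((c - η - c') / 4) * x ^ ((c - η - c') / 4) =
        x ^ (1 - c + η + c' + (c - η - c') / 4 + (c - η - c') / 4) := by
      rw [← Real.rpow_add hx0, ← Real.rpow_add hx0]
    have s4 : x ^ (1 - c + η + c') * Real.log x * Real.log x ≤
        x ^ (1 - c + η + c') * x ^ ((c - η - c') / 4) * x ^ ((c - η - c') / 4) := by
      have hnn : 0 ≤ x ^ (1 - c + η + c') := Real.rpow_nonneg hx0.le _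
      exact mul_le_mul (mul_le_mul_of_nonneg_left hlogle hnn) hlogle hlx (by positivity)
    rw [hprod] at s4
    have s5 : 2 * x ^ (1 - c + η + c') * Real.log x ≤ x / (32 * K * Real.log x) := by
      rw [le_div_iff₀ (by positivity)]
      have : 2 * x ^ (1 - c + η + c') * Real.log x * (32 * K * Real.log x) =
          64 * K * (x ^ (1 - c + η + c') * Real.log x * Real.log x) := by ring
      rw [this]
      have := mul_le_mul_of_nonneg_left s4 (by positivity : (0 : ℝ) ≤ 64 * K)
      linarith
    calc _ ≤ (x ^ (1 - c) * (2 * Real.log x)) * (x ^ η * x ^ c') := s1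
      _ = 2 * x ^ (1 - c + η + c') * Real.log x := s3
      _ ≤ _ := s5
  have hfin := div_log_rpow_lt (by positivity : 0 < 2 * K) (by linarith) e4'
  -- assemble: `x/(8K log x) − x/(32 K log x) ≤ main ≤ x/(log x)^B < x/(16 K log x)`
  have hid : x / (8 * K * Real.log x) - x / (32 * K * Real.log x) - x / (8 * (2 * K) * Real.log x)
      = x / (32 * K * Real.log x) := by
    have hlxne : Real.log x ≠ 0 := hlx0.ne'
    have hKne : K ≠ 0 := hK0.ne'
    field_simp
    ring
  have hpos : 0 < x / (32 * K * Real.log x) := by positivity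
  linarith only [hmain, hsum, hSlow, hsubtr, hfin, hid, hpos]
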